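import Summits.BirchSwinnertonDyer.BirchSwinnertonDyer.Theorems.SignedLowerHalvesSprungLowerHalfAtThreeChromaticCongruenceTransfer
import Summits.BirchSwinnertonDyer.Rank1Residual.X2.EulerFactorInvariants
import Summits.BirchSwinnertonDyer.Rank1Residual.X2.GreenbergVatsalAnalyticTransferCore
import Summits.BirchSwinnertonDyer.Rank1Residual.Supersingular.SprungPollackConsistency
import Summits.BirchSwinnertonDyer.Rank1Residual.Supersingular.KobayashiSqueezeReal
import Literature.NumberTheory.EllipticCurves.Kobayashi2003.SignedPAdicLFunctionUniqueProofs
import HarnessLib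

/-!
# Route `SignedLowerHalves`, crux `KobayashiMainConjectureSmallImage` (item stmt-BirchSwinnertonDyer-19002):
# the ANALYTIC `(μ, λ)`-transfer for Kobayashi's `L^ε_p` along a Mazur–Tate congruence («L4-AN», part 1 of 2:
# `μ(L^ε_p(E)) = 0` and `λ(L^ε_p(E)) + Σδ_E = λ(L^ε_p(E′)) + Σδ_{E′}` from a partner with `μ = 0`)
# (cell `bsd-ssimc`, seat `bsd-ssimc-k3-c4` gen 7; a `--supports stmt-BirchSwinnertonDyer-19002 --as helper` file)

PARTITION (cell bsd-ssimc): X7 (A7) × item 4's non-surjective `a_p = 0` window pairs WITH a `p`-congruent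
partner (79 CM-EC-partnered + 7 unit-partnered), ALL ranks — types-the-object-of (the E-side analytic input of
the small-image congruence road becomes ONE displayed mod-`p` congruence of Mazur–Tate elements instead of a
two-engine Iwasawa-invariant certificate); the crux stays OPEN (`stub_lowerSmallImage` has no engine); closes
none; nothing booked; BSD is not proved by any of this. THEOREMS ONLY: no definition, no named fact, nothing
about any curve asserted.

## What is proved (modulo the displayed hypothesis `hMT`)

For `p` odd, `E = W`, `E′ = W′` good at `p` with `a_p(E) = a_p(E′) = 0`, newforms `f`, `f′` (any levels),
unit-content multipliers `P, P′ ∈ Λ`, a unit `c ∈ ℤ_p`, and EVERY sign `ε`: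
* §1 `hasUnitContent_and_lam_add_eq_of_mazurTate_congr`: `μ(L^ε_p(E′)) = 0 ⟹ μ(L^ε_p(E)) = 0` and
  `λ(L^ε_p(E)) + λ(P) = λ(L^ε_p(E′)) + λ(P′)` — k3-c5's kernel Λ-lemma
  `ChromaticCongruence.C_dvd_sub_of_isSprungPair_of_mazurTate_congr` (any traces `p ∣ a_i`; crux 5's «L5-AN»)
  read at trace `0`, where Sprung's characterisation IS Pollack's pair of congruences (`isSprungPair_zero_iff`)
  and Kobayashi's `L^ε_p` (`IsSignedPAdicLFunction`, his labelling: `ε = −1` ↔ odd layers ↔ the tree's `L⁺`,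
  `ε = 1` ↔ even layers ↔ `L⁻`) is unique (`IsSignedPAdicLFunction.unique`); Pollack's theorem is the tree's
  `pollack_exists_plusMinusPAdicLFunction_holds`.
* §2 `mu_eq_zero_and_lam_add_sum_delta_eq_of_mazurTate_congr`: with `P, P′ = ∏_{S₀} 𝒫_ℓ` Greenberg–Vatsal's
  Euler-factor elements (`eulerFactorProduct`; `μ(𝒫_ℓ) = 0`, `λ(𝒫_ℓ) = s_ℓ d_ℓ = δ` are KERNEL theorems of
  `X2.EulerFactorInvariants`), `S₀ ∌ p`: `λ(L^ε_p(E)) + Σ_{S₀} δ_E = λ(L^ε_p(E′)) + Σ_{S₀} δ_{E′}` — the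
  ANALYTIC twin of B. D. Kim 2009 Cor. 2.13's λ-statement (`BDKim2009.cor213_signedLambda_add_sum_delta_eq_of_torsionIso`).
Part 2 (`…SmallImageAnalyticTransferRoad.lean`) composes this with Kim 2009 and Kobayashi Thm. 4.1 (rational)
into Kobayashi's main conjecture for `E` from a congruent partner's main conjecture + `μ = 0`.

## The displayed hypothesis `hMT` (never asserted, never discharged here) and its printed status

`hMT : ∀ n, ∃ q r ∈ Λ, θ_n(f)·ι P − ι(c)·θ_n(f′)·ι P′ = ι(ω_n q + p r)`: the Mazur–Tate elements multiplied by
`P, P′` are congruent mod `(p, ω_n)` up to `c`. For `P, P′ = ∏_{S₀} 𝒫_ℓ` these are the Mazur–Tate elements of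
the `S₀`-DEPLETED forms up to the common unit `∏_ℓ ℓ(1+T)^{−2f_ℓ}` of `Λ` (the depletion
`f ↦ f − a_ℓ f|V_ℓ + ℓ f|V_ℓ²` multiplies `θ_n` by `1 − a_ℓ(1+T)^{−f_ℓ} + ℓ(1+T)^{−2f_ℓ} = ℓ(1+T)^{−2f_ℓ}·𝒫_ℓ`).
IN PRINT: Corpuz–Lei arXiv:2508.09733 (2025, PRE) §2.2 / Prop. 4.2 (`k = 2 < p`, unramified coefficients,
both forms non-ordinary) — inside its printed scope at every item-4 prime, published inputs (Faltings–Jordan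
1995 multiplicity one for `p ∤ M`, `p > k`; Greenberg–Stevens 1993; Diamond–Flach–Guo 2004); Vatsal, Duke
Math. J. 98 (1999) Thm. 1.10 (canonical periods) — NOT HELD (acq-12175; Corpuz–Lei §1 reports its frame as
`p`-ordinary), the Néron/canonical period unit `c` being Greenberg–Vatsal 2000 Rem. 3.4. So for item 4 `hMT`
is PRE-claimed with published ingredients in scope; of Corpuz–Lei's Thms 4.5 / 5.3 / 5.10 (the line of record
L4-CM, p422273) NONE is an input: 4.5/5.3 = §1 here, 5.10 = part 2.

## What this is NOT

Not a class theorem about the crux; not a proof of `hMT`; not a claim that any curve's `L^±_p` has `μ = 0`;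
the two-engine certificates of the L4-λ records (p474509, p475276, p475277, p475614) remain the cell's
PRE-free currency; nothing booked; BSD is not proved by any of this.

References: [GreenbergVatsal2000] §1 (8)–(9), §2 Prop. (2.4), §3 Rem. 3.4; [Pollack2003] Prop. 6.18,
Cor. 5.11; [Sprung2017] §3.1, Cor. 4.4; [Kobayashi2003] Thm. 3.2, (3.4)–(3.6); [BDKim2009] Cor. 2.13;
[CorpuzLei2025] §2.2, Prop. 4.2, Thm. 4.5, Thm. 5.3 (PRE). Memo: `HOME/k3c4-MEMO-7.md` (cell bsd-ssimc).
-/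

set_option autoImplicit false
set_option linter.dupNamespace false
noncomputable section

open scoped Classical MatrixGroups ModularForm BigOperators

open CongruenceSubgroup WeierstrassCurve NumberField IsDedekindDomain
  Literature.NumberTheory.EllipticCurves
  Literature.NumberTheory.EllipticCurves.ModularForms
  Literature.NumberTheory.EllipticCurves.Kobayashi2003
  Literature.NumberTheory.EllipticCurves.GreenbergVatsal2000
  Literature.NumberTheory.EllipticCurves.Sprung2017
  Summit.BirchSwinnertonDyer.Rank1Residual.X1.MuLambda
  Summit.BirchSwinnertonDyer.Rank1Residual.X11a
  Summit.BirchSwinnertonDyer.Rank1Residual.Supersingular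
  Summit.BirchSwinnertonDyer.Rank1Residual.X2.EulerFactorInvariants
  Summit.BirchSwinnertonDyer.Rank1Residual.X2.GreenbergVatsalAnalyticTransferCore
  Summit.BirchSwinnertonDyer.BirchSwinnertonDyer.Theorems.ChromaticCongruence

namespace Summit.BirchSwinnertonDyer.BirchSwinnertonDyer.Theorems.SmallImageAnalyticTransfer

variable {p : ℕ} [hp : Fact p.Prime]

/-! ### §1 The analytic `(μ, λ)`-transfer for Kobayashi's `L^ε_p` along a Mazur–Tate congruence -/

/-- **`μ(L^ε_p(E)) = 0` and `λ(L^ε_p(E)·P) = λ(L^ε_p(E′)·P′)` from a partner with `μ(L^ε_p(E′)) = 0` and the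
displayed congruence `hMT`.** For `p` odd, `E = W`, `E′ = W′` good at `p` with `a_p = 0`, newforms `f`, `f′`
(any levels), unit-content multipliers `P, P′ ∈ Λ`, a unit `c ∈ ℤ_p` and `hMT` (the Mazur–Tate elements
`θ_n(f)·P ≡ c·θ_n(f′)·P′ (mod p, ω_n)` for all `n`): for every sign `ε` and all `L, L′` with
`IsSignedPAdicLFunction f p ε L`, `IsSignedPAdicLFunction f′ p ε L′` (Kobayashi's labelling; unique, = the
corresponding component of Pollack's pair, which at `a_p = 0` is Sprung's pair: `isSprungPair_zero_iff`),
`μ(L′) = 0` implies `μ(L) = 0` (unit content) and `λ(L) + λ(P) = λ(L′) + λ(P′)`. Proof: k3-c5's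
`ChromaticCongruence.C_dvd_sub_of_isSprungPair_of_mazurTate_congr` (`L·P ≡ c·L′·P′ (mod pΛ)`), then
`hasUnitContent_iff_of_C_dvd_sub`, `lam_eq_of_C_dvd_sub`, `lam_mul`. CONDITIONAL on `hMT`; nothing asserted.
[cite: Pollack2003, Prop. 6.18 and Cor. 5.11] [cite: Sprung2017, §3.1 and Cor. 4.4]
[cite: Kobayashi2003, Thm. 3.2 and (3.4)–(3.5) (p. 7)] [cite: GreenbergVatsal2000, p. 2–3, (1)–(2)] -/
theorem hasUnitContent_and_lam_add_eq_of_mazurTate_congr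
    {W W' : WeierstrassCurve ℚ} [W.IsElliptic] [W.IsGloballyMinimal] [W'.IsElliptic]
    [W'.IsGloballyMinimal] (hp2 : p ≠ 2)
    (hgood : W.HasGoodReductionAtPrime p) (hap : W.frobeniusTrace p = 0)
    (hgood' : W'.HasGoodReductionAtPrime p) (hap' : W'.frobeniusTrace p = 0)
    {N N' : ℕ} [NeZero N] [NeZero N'] {f : CuspForm (Gamma0 N) 2} {f' : CuspForm (Gamma0 N') 2}
    (hf : IsNewformOf W f) (hf' : IsNewformOf W' f')
    {P P' : IwasawaAlgebra p} (hP : HasUnitContent P) (hP' : HasUnitContent P')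
    {c : ℤ_[p]} (hc : IsUnit c)
    (hMT : ∀ n : ℕ, ∃ q r : IwasawaAlgebra p,
      ((mazurTateElement f p n).map (algebraMap ℚ ℚ_[p]) : PowerSeries ℚ_[p]) *
            iwasawaToPowerSeries p P -
          iwasawaToPowerSeries p (PowerSeries.C c) *
            (((mazurTateElement f' p n).map (algebraMap ℚ ℚ_[p]) : PowerSeries ℚ_[p]) *
              iwasawaToPowerSeries p P') =
        iwasawaToPowerSeries p
          (toIwasawa p (cyclotomicOmega p n) * q + PowerSeries.C (p : ℤ_[p]) * r))
    (ε : ℤˣ) {L L' : IwasawaAlgebra p} (hL : IsSignedPAdicLFunction f p ε L)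
    (hL' : IsSignedPAdicLFunction f' p ε L') (hμ' : mu L' = 0) :
    HasUnitContent L ∧ lam L + lam P = lam L' + lam P' := by
  -- Pollack's pairs for `f` and `f′`; at trace `0` they are Sprung pairs
  obtain ⟨Lp, Lm, hLp0, hLm0, hodd, heven⟩ :=
    pollack_exists_plusMinusPAdicLFunction_holds (W := W) (f := f) (p := p) hp2 hf hgood hap
  obtain ⟨Lp', Lm', hLp0', hLm0', hodd', heven'⟩ :=
    pollack_exists_plusMinusPAdicLFunction_holds (W := W') (f := f') (p := p) hp2 hf' hgood' hap'
  have hSP : IsSprungPair f p 0 Lp Lm := (isSprungPair_zero_iff f p Lp Lm).mpr ⟨hodd, heven⟩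
  have hSP' : IsSprungPair f' p 0 Lp' Lm' := (isSprungPair_zero_iff f' p Lp' Lm').mpr ⟨hodd', heven'⟩
  have h0 : (p : ℤ) ∣ (0 : ℤ) := dvd_zero _
  obtain ⟨hs, hfl⟩ :=
    C_dvd_sub_of_isSprungPair_of_mazurTate_congr f f' h0 h0 hSP hSP' P P' c hMT
  -- `L`, `L′` are the `ε`-components (uniqueness of Kobayashi's `L^ε_p`)
  have key : PowerSeries.C (p : ℤ_[p]) ∣ (L * P - PowerSeries.C c * (L' * P')) ∧ L' ≠ 0 := by
    rcases Int.units_eq_one_or ε with rfl | rfl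
    · have h1 : L = Lm := hL.unique ((isSignedPAdicLFunction_one_iff f p Lm).mpr heven)
      have h2 : L' = Lm' := hL'.unique ((isSignedPAdicLFunction_one_iff f' p Lm').mpr heven')
      rw [h1, h2]
      exact ⟨hfl, hLm0'⟩
    · have h1 : L = Lp := hL.unique ((isSignedPAdicLFunction_neg_one_iff f p Lp).mpr hodd)
      have h2 : L' = Lp' := hL'.unique ((isSignedPAdicLFunction_neg_one_iff f' p Lp').mpr hodd')
      rw [h1, h2]
      exact ⟨hs, hLp0'⟩
  obtain ⟨hdvd, hL'0⟩ := key
  have hμ'U : HasUnitContent L' := hasUnitContent_of_mu_eq_zero hL'0 hμ'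
  have hU' : HasUnitContent (L' * P') := (hasUnitContent_mul_iff_of_hasUnitContent hP').mpr hμ'U
  have hU : HasUnitContent (L * P) := (hasUnitContent_iff_of_C_dvd_sub hc hdvd).mpr hU'
  have hLU : HasUnitContent L := (hasUnitContent_mul_iff_of_hasUnitContent hP).mp hU
  refine ⟨hLU, ?_⟩
  have hlam := lam_eq_of_C_dvd_sub hc hdvd hU
  rwa [lam_mul (ne_zero_of_hasUnitContent hLU) (ne_zero_of_hasUnitContent hP),
    lam_mul (ne_zero_of_hasUnitContent hμ'U) (ne_zero_of_hasUnitContent hP')] at hlam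

/-! ### §2 With Greenberg–Vatsal's Euler-factor elements: `λ(L^ε_p(E)) + Σδ_E = λ(L^ε_p(E′)) + Σδ_{E′}` -/

/-- **`∏_{S₀} 𝒫_ℓ(T)` has unit content and `λ(∏_{S₀} 𝒫_ℓ) = Σ_{S₀} δ_E`** for a finite set `S₀` of places
none above `p` (`p` odd) — the kernel theorems `order_map_toZMod_eulerFactorProduct` (GV Prop. (2.4):
`μ(𝒫_ℓ) = 0`, `λ(𝒫_ℓ) = s_ℓ d_ℓ`) read through `λ = ord_T(· mod p)` (`natCast_lam_eq_order_map_toZMod`), in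
the cell's spelling `(p : 𝓞 ℚ) ∉ v` of "`v ∤ p`". [cite: GreenbergVatsal2000, §1 (8)–(9) and §2 Prop. (2.4) (p. 22)] -/
theorem hasUnitContent_and_lam_eulerFactorProduct (W : WeierstrassCurve ℚ) (hp2 : p ≠ 2)
    (S₀ : Finset (HeightOneSpectrum (𝓞 ℚ))) (hS₀ : ∀ v ∈ S₀, ((p : ℕ) : 𝓞 ℚ) ∉ v.asIdeal) :
    HasUnitContent (eulerFactorProduct W p S₀) ∧
      lam (eulerFactorProduct W p S₀) = ∑ v ∈ S₀, delta W p v := by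
  have hS : ∀ v ∈ S₀, Rat.HeightOneSpectrum.natGenerator v ≠ p := fun v hv =>
    natGenerator_ne_of_natCast_not_mem v (hS₀ v hv)
  obtain ⟨hU, hord⟩ := order_map_toZMod_eulerFactorProduct W S₀ hp2 hS
  refine ⟨hU, ?_⟩
  have h := natCast_lam_eq_order_map_toZMod hU
  rw [hord] at h
  exact_mod_cast h

/-- **The analytic twin of B. D. Kim 2009 Cor. 2.13 (λ): `μ(L^ε_p(E)) = 0` and
`λ(L^ε_p(E)) + Σ_{S₀} δ_E = λ(L^ε_p(E′)) + Σ_{S₀} δ_{E′}`** from a partner with `μ(L^ε_p(E′)) = 0` and the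
displayed congruence `hMT` of the `S₀`-depleted Mazur–Tate elements (multipliers = Greenberg–Vatsal's
`∏_{S₀} 𝒫_ℓ` of `E` and `E′`, `S₀ ∌ p`), `p` odd, both curves good at `p` with `a_p = 0`. (GV display (9),
`λ^{an}_{Σ₀} = λ^{an} + Σδ`, for BOTH curves, and §1.) CONDITIONAL on `hMT`; nothing asserted.
[cite: GreenbergVatsal2000, §1 (8)–(9), §2 Prop. (2.4) (p. 22)] [cite: BDKim2009, Cor. 2.13 (p. 187)]
[cite: Pollack2003, Prop. 6.18 and Cor. 5.11] -/
theorem mu_eq_zero_and_lam_add_sum_delta_eq_of_mazurTate_congr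
    {W W' : WeierstrassCurve ℚ} [W.IsElliptic] [W.IsGloballyMinimal] [W'.IsElliptic]
    [W'.IsGloballyMinimal] (hp2 : p ≠ 2)
    (hgood : W.HasGoodReductionAtPrime p) (hap : W.frobeniusTrace p = 0)
    (hgood' : W'.HasGoodReductionAtPrime p) (hap' : W'.frobeniusTrace p = 0)
    {N N' : ℕ} [NeZero N] [NeZero N'] {f : CuspForm (Gamma0 N) 2} {f' : CuspForm (Gamma0 N') 2}
    (hf : IsNewformOf W f) (hf' : IsNewformOf W' f')
    (S₀ : Finset (HeightOneSpectrum (𝓞 ℚ))) (hS₀ : ∀ v ∈ S₀, ((p : ℕ) : 𝓞 ℚ) ∉ v.asIdeal)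
    {c : ℤ_[p]} (hc : IsUnit c)
    (hMT : ∀ n : ℕ, ∃ q r : IwasawaAlgebra p,
      ((mazurTateElement f p n).map (algebraMap ℚ ℚ_[p]) : PowerSeries ℚ_[p]) *
            iwasawaToPowerSeries p (eulerFactorProduct W p S₀) -
          iwasawaToPowerSeries p (PowerSeries.C c) *
            (((mazurTateElement f' p n).map (algebraMap ℚ ℚ_[p]) : PowerSeries ℚ_[p]) *
              iwasawaToPowerSeries p (eulerFactorProduct W' p S₀)) =
        iwasawaToPowerSeries p
          (toIwasawa p (cyclotomicOmega p n) * q + PowerSeries.C (p : ℤ_[p]) * r))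
    (ε : ℤˣ) {L L' : IwasawaAlgebra p} (hL : IsSignedPAdicLFunction f p ε L)
    (hL' : IsSignedPAdicLFunction f' p ε L') (hμ' : mu L' = 0) :
    mu L = 0 ∧ lam L + ∑ v ∈ S₀, delta W p v = lam L' + ∑ v ∈ S₀, delta W' p v := by
  obtain ⟨hP, hlamP⟩ := hasUnitContent_and_lam_eulerFactorProduct W hp2 S₀ hS₀
  obtain ⟨hP', hlamP'⟩ := hasUnitContent_and_lam_eulerFactorProduct W' hp2 S₀ hS₀
  obtain ⟨hU, hlam⟩ := hasUnitContent_and_lam_add_eq_of_mazurTate_congr hp2 hgood hap hgood' hap' hf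
    hf' hP hP' hc hMT ε hL hL' hμ'
  rw [hlamP, hlamP'] at hlam
  exact ⟨mu_eq_zero_of_hasUnitContent hU, hlam⟩

end Summit.BirchSwinnertonDyer.BirchSwinnertonDyer.Theorems.SmallImageAnalyticTransfer

end
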